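import Summits.BirchSwinnertonDyer.BirchSwinnertonDyer.Theorems.AdditiveBranchIMCTwistRootNumberAnyTwo
import HarnessLib

/-!
# The E3′ root-number engine — auxiliary reduction lemmas at the primes of the twist parameter (LEAD g15)

Theorems only (no definition, no named fact, no `sorry`). Two local lemmas for `AdditiveBranchIMCTwistRootNumberTwisted.lean` (brick E3′ of
crux 19357 / 19358, pen memo e19 v6 §4 (g); sketch `Cruxes/GordTwoRankOne/TwistedWanSketch.lean` v4 `EngineTwisted`): at a prime `r ∥ D`
(`r` odd) where `E` has GOOD reduction, the twist `E^{(D)}` is ADDITIVE (`hasAdditiveReductionAt_quadraticTwist_of_good`, the place-of-`ℤ`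
form of the tree's `hasAdditiveReductionAt_quadraticTwist_of_dvd`) and OF QUADRATIC-TWIST TYPE — `(E^{(D)})^{(r*)} ≅ E^{(±D/r)}` is not
additive at `r` (`not_hasAdditiveReductionAt_quadraticTwist_pStar_of_good`, the square-removal trick of
`not_hasAdditiveReductionAt_quadraticTwist_mul_pStar_right`); plus `χ₄ n = −1` for `n ≡ 3 (mod 4)`. BSD is proved for no curve by any of this.
References: [SilvermanAEC2009] VII.5 Prop. 5.1, X.5 Cor. 5.4.
-/

set_option linter.dupNamespace false
set_option autoImplicit false

noncomputable section

open scoped Classical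

open Literature.NumberTheory.EllipticCurves Literature.NumberTheory.EllipticCurves.ModularForms
  IsDedekindDomain IsDedekindDomain.HeightOneSpectrum NumberField Rat.HeightOneSpectrum WeierstrassCurve
  Summit.BirchSwinnertonDyer.BirchSwinnertonDyer.Theorems

namespace Summit.BirchSwinnertonDyer.BirchSwinnertonDyer.Theorems.TwistRootNumberTwisted

variable (W : WeierstrassCurve ℚ) [W.IsElliptic] [W.IsGloballyMinimal]

/-- `natGenerator` of the place of `ℤ` under a prime `p` is `p` (the tree's `Rat.natGenerator_primesEquiv_symm`). [folklore] -/
private theorem natGenerator_symm' (p : Nat.Primes) : natGenerator ((primesEquiv (R := ℤ)).symm p) = p :=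
  Literature.NumberTheory.EllipticCurves.Rat.natGenerator_primesEquiv_symm p

/-- `χ₄` of a natural number `≡ 3 (mod 4)` given as an integer cast is `−1`. [folklore] -/
theorem χ₄_natCast_eq_neg_one_of_mod_four {n : ℕ} (h : n % 4 = 3) : ZMod.χ₄ (n : ZMod 4) = -1 :=
  ZMod.χ₄_nat_three_mod_four h

omit [W.IsGloballyMinimal] in
/-- **`E^{(D)}` twisted by `r*` is not additive at a prime `r ∥ D` where `E` is GOOD** (`D·r* = (±D/r)·r²`, and the twist by the
`r`-unit `±D/r` keeps good reduction at `r`): the additive prime `r` of `E^{(D)}` is of quadratic-twist type.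
[cite: SilvermanAEC2009, X.5 Cor. 5.4 and VII.5 Prop. 5.1] -/
theorem not_hasAdditiveReductionAt_quadraticTwist_pStar_of_good {D : ℤ} (R : Nat.Primes) (hR2 : (R : ℕ) ≠ 2) {u : ℤ}
    (hDu : D = R * u) (hRu : ¬ ((R : ℕ) : ℤ) ∣ u) (hgood : W.HasGoodReductionAt ((primesEquiv (R := ℤ)).symm R)) :
    ¬ ((W.quadraticTwist (D : ℚ)).quadraticTwist (((-1 : ℤ) ^ ((R : ℕ) / 2) * R : ℤ) : ℚ)).HasAdditiveReductionAt
      ((primesEquiv (R := ℤ)).symm R) := by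
  set s : ℤ := (-1 : ℤ) ^ ((R : ℕ) / 2) with hs
  have hgen : natGenerator ((primesEquiv (R := ℤ)).symm R) = R := natGenerator_symm' R
  have hv2 : natGenerator ((primesEquiv (R := ℤ)).symm R) ≠ 2 := by rw [hgen]; exact hR2
  have hu0 : u ≠ 0 := by rintro rfl; exact hRu (dvd_zero _)
  have hsu0 : ((s * u : ℤ) : ℚ) ≠ 0 := by
    have : s * u ≠ 0 := mul_ne_zero (pow_ne_zero _ (by norm_num)) hu0
    exact_mod_cast this
  haveI := W.isElliptic_quadraticTwist hsu0
  have key : (W.quadraticTwist (D : ℚ)).quadraticTwist (((-1 : ℤ) ^ ((R : ℕ) / 2) * R : ℤ) : ℚ) =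
      (W.quadraticTwist ((s * u : ℤ) : ℚ)).quadraticTwist ((((R : ℕ) : ℚ)) ^ 2) := by
    rw [quadraticTwist_quadraticTwist, quadraticTwist_quadraticTwist, ← hs, hDu]
    congr 1
    push_cast
    ring
  obtain ⟨C, hC⟩ := (W.quadraticTwist ((s * u : ℤ) : ℚ)).exists_variableChange_smul_eq_quadraticTwist_sq
    (θ := ((R : ℕ) : ℚ)) (by exact_mod_cast R.2.ne_zero)
  have hsu : ¬ ((natGenerator ((primesEquiv (R := ℤ)).symm R) : ℕ) : ℤ) ∣ s * u := by
    rw [hgen]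
    intro h
    exact hRu (((isUnit_neg_one (α := ℤ)).pow _).dvd_mul_left.mp h)
  rw [key, ← hC, hasAdditiveReductionAt_smul_iff_holds _ (W.quadraticTwist ((s * u : ℤ) : ℚ)) C,
    (W.hasReductionAt_quadraticTwist_iff_of_not_dvd _ hv2 hsu).2.2]
  exact hgood.not_hasAdditiveReductionAt

/-- **`E^{(D)}` is additive at a prime `r ∥ D` (`r` odd) where `E` is good.** [cite: SilvermanAEC2009, VII.5 Prop. 5.1] -/
theorem hasAdditiveReductionAt_quadraticTwist_of_good {D : ℤ} (hD0 : D ≠ 0) (R : Nat.Primes) (hR2 : (R : ℕ) ≠ 2)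
    (h1 : ((R : ℕ) : ℤ) ∣ D) (h2 : ¬ ((R : ℕ) : ℤ) ^ 2 ∣ D) (hgood : W.HasGoodReductionAt ((primesEquiv (R := ℤ)).symm R)) :
    (W.quadraticTwist (D : ℚ)).HasAdditiveReductionAt ((primesEquiv (R := ℤ)).symm R) := by
  haveI := W.isElliptic_quadraticTwist (show (D : ℚ) ≠ 0 by exact_mod_cast hD0)
  haveI := Fact.mk R.2
  set v : HeightOneSpectrum (𝓞 ℚ) := (primesEquiv (R := 𝓞 ℚ)).symm R with hv
  have hvP : primesEquiv v = R := by rw [hv, Equiv.apply_symm_apply]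
  have hgoodO : W.HasGoodReductionAt v := by
    have hg : (haveI := Fact.mk (primesEquiv v).2; W.HasGoodReductionAtPrime (primesEquiv v : ℕ)) := by
      rw [hvP]; exact (W.hasGoodReductionAtPrime_iff_hasGoodReductionAt_holds R).mpr hgood
    exact (hasGoodReductionAtPrime_iff_hasGoodReductionAt_ringOfIntegers v W).mp hg
  have hadd := W.hasAdditiveReductionAt_quadraticTwist_of_dvd v (by rw [hvP]; exact hR2) hD0 (by rw [hvP]; exact h1)
    (by rw [hvP]; exact h2) hgoodO
  exact ((W.quadraticTwist (D : ℚ)).hasAdditiveReductionAt_int_iff_ringOfIntegers R).mpr hadd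

end Summit.BirchSwinnertonDyer.BirchSwinnertonDyer.Theorems.TwistRootNumberTwisted

end
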